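import Summits.ABC.IUTFork.Cor312DeepGradedBoxes
import HarnessLib

/-!
# [IUTchIII] Cor. 3.12 — the LIN-SCALED bed P♮ˡ (honest asymmetric graded split model), II: profiles, profile points, data, setting, q-datum

Record-only file (D-0012; MODEL DATA, no `Prop` fact) of the abc-iut cell (IUT REPAIR branch B, seat abc-iut-rp-x3 gen 4; rung
LADDER-ABC:A2.RP; abc-iut-rp-plan ruling (R30) 2026-08-26T12:39:05Z: abc-iut-rp-s1's MODEL-WANTED «an SSFrame bed with (ii)(b), the typed
Statement and Scholze–Stix's (Lin) with ONE scalar 0 < r ≠ 1» — a cell for abc-iut-rp-m4's row RP-M51 (`Repair.CandMochizuki41`) and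
abc-iut-rp-s1's `Repair/ObstructionSS25`/`…SS27`). TAKES NO SIDE on [IUTchIII] Cor. 3.12 and no side between Mochizuki, Scholze–Stix, Joshi or
Dupuy–Hilado; a model of READING PREDICATES is a consistency witness, not an endorsement; typed ≠ proved; model data ≠ intended objects.
Sequel of `Cor312DeepGradedBoxes` (cap-parametric graded frame `deepFrame D`, volume `deepVol D`, region operator `deepRegion D`) over
abc-iut-w5-d230's split shells and abc-iut-rp-h3's P♮ₑ machinery (imported BY NAME, nothing restated).

THE BED P♮ˡ (this file = the model data; proofs in parts III `Cor312LinScaledThm311` and IV `Repair/EvalLinScaledCorner`). Cap `capL = 8`. At the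
label `j` of `𝔽_l^⋇` the Θ-datum is the PROFILE POINT `profilePt (thetaDepth j)` = `Σ_{c : c(j) = true} 2^{−thetaDepth j c}·e_c` of the packet
— supported, as [IUTchIII] Prop. 3.4 (ii) requires, on the coordinates through the bad summand of the LAST factor — with the ASYMMETRIC depth
profile `thetaDepth`: label 1 (coordinates `c₀c₁`): `FT ↦ 2`, `TT ↦ 1` (total 3, volume `−3/4`); label 2 (`c₀c₁c₂`): `FFT ↦ 8`, `TFT ↦ 8`,
`TTT ↦ 8`, `FTT ↦ 0` (total 24, volume `−3 = 2²·(−3/4)`: HONEST `j²`-scaling); the q-datum is `profilePt (qDepth j)` with the label-uniform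
profile «`1` on the usable coordinates with `c₀ = true`, `2` on those with `c₀ = false`» (totals 3, 6: volume `−3/4` at BOTH labels: NATURAL
q-side) — a genuine point of the packet, NOT an ⟨(Ind1)∪(Ind2)⟩-translate of the Θ-datum. Under the (Ind1) capsule permutations only the
coordinate `c ≡ true` survives the class-wise minimum (every other class meets a coordinate with `c(j) = false`), so the holomorphic hull at
label `j` is the box of depth `thetaDepth j (c ≡ true) = j³` there (parts III): volumes `−1/4`, `−1` — ONE THIRD of the Θ-volumes at both
labels, i.e. (Lin) with the uniform scalar `r = 1/3`, while `−|log(Θ)| = −5/8 > −3/4 = −|log(q)|` (Statement STRICT) and `S` fails.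
Data (a)(b)(c) `linData` (unit box, everything admissible, volume `deepVol capL`), column `linColumn` (identity Kummer transport), situation
`linFull` (link data abc-iut-w5-d247's `naiveLink`), setting `linSetting` (column `0`, honest pilots of exponent `1`, the DEEP frame
`deepFrame capL`, glue reading the exponent), region operator `deepRegion capL`, q-datum `qDatumL`.
HONEST SCOPE: interface-level toy (`l⋇ = 2`, one place, rational «norms»); the mover is (Ind1)'s capsule permutation acting on an
ASYMMETRIC polydisc ([IUTchIV] Thm. 1.10 Step (v) «symmetrizing with respect to the choice of i† ∈ I» read from below), the volume is the
honest average-depth log-volume of P♮ₑ (no table); not [IUTchI] Def. 3.1 data. [claim: Mochizuki2012, status: disputed] for every IUT noun.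
[cite: ScholzeStix2018, §2.2 pp. 9–10] [cite: DupuyHilado2020, §4.7, §6.2]
-/

noncomputable section

open Set

namespace Summit.ABC.IUTFork.Cor312Vol

namespace LinScaledWitness

open Thm311 Cor312 Cor312.IdentifiedNonVacuity NaiveWitness PinnedWitness SplitWitness ExcursionWitness DeepBoxes
  Literature.IUT.LogThetaLattice

/-! ## 4. The cap, the two depth profiles, the profile points -/

/-- The DEPTH CAP of P♮ˡ: `8 = 2³`, the hull depth needed at label `2` for the scalar `1/3`. [folklore] -/
def capL : ℕ := 8

/-- **The Θ-DEPTH PROFILE of P♮ˡ** at label `j`, on the coordinates `c : S^±_{j+1} → Bool` of the packet (depth `0` off the bad summand of the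
last factor, `c(j) = false`): label `1`: `TT ↦ 1`, `FT ↦ 2`; label `2`: `FTT ↦ 0`, `FFT, TFT, TTT ↦ 8`; label `0`: `0`. Totals `0, 3, 24` —
average depths `0, 3/4, 3 = j²·(3/4)`: HONEST `j²`-scaling against the q-profile. MODEL DATA. [folklore] -/
def thetaDepth (j : splitIndex.Label) (c : splitIndex.Caps j → Bool) : ℕ :=
  if c (Fin.last _) = true then
    (if (j : ℕ) = 1 then (if c 0 = true then 1 else 2)
     else if (j : ℕ) = 2 then (if (c 0 = false ∧ c 1 = true) then 0 else 8) else 0)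
  else 0

/-- **The q-DEPTH PROFILE of P♮ˡ** (label-uniform rule): on the usable coordinates (`c(j) = true`) depth `1` if `c₀ = true`, `2` if
`c₀ = false`; `0` elsewhere. Totals `1, 3, 6` at the labels `0, 1, 2` — average depth `3/4` at EVERY label of `𝔽_l^⋇` (NATURAL q-side).
MODEL DATA. [folklore] -/
def qDepth (j : splitIndex.Label) (c : splitIndex.Caps j → Bool) : ℕ :=
  if c (Fin.last _) = true then (if c 0 = true then 1 else 2) else 0

/-- The Θ-profile vanishes off the bad summand of the last factor. [folklore] -/
theorem thetaDepth_of_last_false {j : splitIndex.Label} {c : splitIndex.Caps j → Bool} (hc : c (Fin.last _) = false) : thetaDepth j c = 0 := by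
  unfold thetaDepth; rw [if_neg (by rw [hc]; decide)]

/-- The q-profile vanishes off the bad summand of the last factor. [folklore] -/
theorem qDepth_of_last_false {j : splitIndex.Label} {c : splitIndex.Caps j → Bool} (hc : c (Fin.last _) = false) : qDepth j c = 0 := by
  unfold qDepth; rw [if_neg (by rw [hc]; decide)]

/-- The Θ-profile is capped by `capL`. [folklore] -/
theorem thetaDepth_le (j : splitIndex.Label) (c : splitIndex.Caps j → Bool) : thetaDepth j c ≤ capL := by
  unfold thetaDepth capL; split_ifs <;> omega

/-- The q-profile is capped by `capL`. [folklore] -/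
theorem qDepth_le (j : splitIndex.Label) (c : splitIndex.Caps j → Bool) : qDepth j c ≤ capL := by
  unfold qDepth capL; split_ifs <;> omega

/-- On the all-`true` coordinate the Θ-profile is `j³` (`1` at label `1`, `8` at label `2`) — the depth that will survive the (Ind1)-orbit.
[folklore] -/
theorem thetaDepth_top (j : splitIndex.Label) : thetaDepth j (fun _ => true) = (j : ℕ) ^ 3 := by
  have hj : (j : ℕ) ≤ 2 := Nat.lt_succ_iff.1 j.2
  unfold thetaDepth
  simp only [Bool.true_eq_false, false_and, if_false, if_true]
  interval_cases h : (j : ℕ) <;> simp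

/-- **The PROFILE POINT** of a depth profile `d`: `Σ_{c : c(j) = true} 2^{−d c}·e_c` — value `2^{−d c}` on every coordinate through the bad
summand of the last factor, `0` on the others ([IUTchIII] Prop. 3.4 (ii): the splitting monoid in the sub-packet `𝓘^ℚ(^{S^±_{j+1},j};−)_v`).
MODEL DATA. [claim: Mochizuki2012, status: disputed] -/
def profilePt (d : ∀ j : splitIndex.Label, (splitIndex.Caps j → Bool) → ℕ) (j : splitIndex.Label) (vQ : splitIndex.VQ) :
    splitShells.Packet j vQ :=
  ∑ c : splitIndex.Caps j → Bool, (if c (Fin.last _) = true then ((2 : ℚ)⁻¹ ^ d j c) else 0) • ePt j vQ c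

/-- **The coordinates of a profile point**: `2^{−d c}` on a coordinate with `c(j) = true`, `0` otherwise. [folklore] -/
theorem coord_profilePt (d : ∀ j : splitIndex.Label, (splitIndex.Caps j → Bool) → ℕ) (j : splitIndex.Label) (vQ : splitIndex.VQ)
    (c : splitIndex.Caps j → Bool) :
    coord j vQ c (profilePt d j vQ) = if c (Fin.last _) = true then ((2 : ℚ)⁻¹ ^ d j c) else 0 := by
  unfold profilePt
  rw [map_sum]
  simp only [coord_smul_ePt]
  rw [Finset.sum_ite_eq Finset.univ c]
  simp

/-- **The Θ-DATUM of P♮ˡ** in `∏_{j ∈ 𝔽_l^⋇}` at a valuation: the profile point of `thetaDepth`. MODEL DATA. [claim: Mochizuki2012, status: disputed] -/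
def thetaStarL (v : splitIndex.V) : splitShells.StarPacket v := fun j => profilePt thetaDepth j.1 (splitIndex.over v)

/-- **The q-DATUM of P♮ˡ**: the profile point of `qDepth` — a genuine point of the packet, NOT an ⟨(Ind1)∪(Ind2)⟩-translate of the Θ-datum
(the uninterpreted binder `qK` of abc-iut-w5-d230's pins). MODEL DATA. [claim: Mochizuki2012, status: disputed] -/
def qStarL (v : splitIndex.V) : splitShells.StarPacket v := fun j => profilePt qDepth j.1 (splitIndex.over v)

/-! ## 5. Data (a)(b)(c), column, full situation -/

/-- **The data (a)(b)(c) of P♮ˡ** ([IUTchIII] Thm. 3.11 (i)): integral structure the unit box `gbox 0`, everything admissible, log-volume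
`deepVol capL`, splitting monoid the Θ-datum, number field the whole global packet. [claim: Mochizuki2012, status: disputed] -/
def linData : MRData splitShells where
  shellPk := fun _ _ => gbox 0
  shellSub := fun _ _ => gbox 0
  Adm := fun _ _ _ => True
  logvol := fun j vQ A => deepVol capL j vQ A
  Ψ := fun v _ => {thetaStarL v}
  act := fun _ _ _ => 0
  Mmod := fun _ => Set.univ

/-- (c)'s global realified Frobenioids: one object, region the unit box, degree its log-volume. [claim: Mochizuki2012, status: disputed] -/
def linDegrees (j : splitIndex.LabelStar) : GlobalDegrees splitShells j where
  ObjMOD := Unit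
  Objmod := Unit
  natIso := Equiv.refl Unit
  deg := fun _ => deepVol capL j.1 () (gbox 0)
  region := fun _ _ => gbox 0

/-- The SITUATION of P♮ˡ (bi-coric strictification: the same data on every vertical line). (An `abbrev`.) [claim: Mochizuki2012, status: disputed] -/
abbrev linSituation : Situation splitIndex where
  L := splitShells
  D := fun _ => linData
  G := fun _ j => linDegrees j

/-- The COLUMN of P♮ˡ: identity Kummer transport at every `(n, m)`, unit-group and ball images the unit box. [claim: Mochizuki2012, status: disputed] -/
def linColumn : Column splitShells where
  frobAdm := fun _ _ _ _ => True
  frobLogvol := fun _ j vQ A => deepVol capL j vQ A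
  frobΨ := fun _ v _ => {thetaStarL v}
  frobMmod := fun _ _ => Set.univ
  unitImage := fun _ _ _ _ => gbox 0
  ballImage := fun _ _ _ => gbox 0
  ObjLGP := ℤ
  frobObjLGP := fun _ => ℤ
  kumLGP := fun _ => Equiv.refl ℤ
  ObjLgp := ℤ
  frobObjLgp := fun _ => ℤ
  kumLgp := fun _ => Equiv.refl ℤ
  thetaPilot := fun _ => 1

/-- The FULL SITUATION of [IUTchIII] Thm. 3.11 for P♮ˡ (link data abc-iut-w5-d247's `naiveLink`). (An `abbrev`.) [claim: Mochizuki2012, status: disputed] -/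
abbrev linFull : FullSituation splitIndex where
  toSituation := linSituation
  col := fun _ => linColumn
  link := naiveLink

/-! ## 6. The setting: honest pilot objects, the DEEP graded frame, glue reading the exponent -/

/-- The Θ-GLUE reading the object: the lgp-object of exponent `k` at label `j ∈ 𝔽_l^⋇` is the graded box of depth `k·thetaDepth j`
(`k = 1` for the pilot); the unit box at the zero label. [claim: Mochizuki2012, status: disputed] -/
def thetaGlueL (k : ℤ) (j : splitIndex.Label) (vQ : splitIndex.VQ) : Set (splitShells.Packet j vQ) :=
  if j = 0 then gbox 0 else gbox (fun c => k.toNat * thetaDepth j c)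

/-- The q-GLUE reading the object: the `△`-object of exponent `k` at label `j ∈ 𝔽_l^⋇` is the graded box of depth `k·qDepth j`; the unit
box at the zero label. [claim: Mochizuki2012, status: disputed] -/
def qGlueL (k : ℤ) (j : splitIndex.Label) (vQ : splitIndex.VQ) : Set (splitShells.Packet j vQ) :=
  if j = 0 then gbox 0 else gbox (fun c => k.toNat * qDepth j c)

/-- At exponent `1` the Θ-glue is `gbox (thetaDepth j)` on `𝔽_l^⋇`. [folklore] -/
theorem thetaGlueL_one_of_ne_zero {j : splitIndex.Label} (hj : j ≠ 0) (vQ : splitIndex.VQ) : thetaGlueL 1 j vQ = gbox (thetaDepth j) := by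
  unfold thetaGlueL; rw [if_neg hj]
  exact congrArg gbox (funext fun c => by rw [Int.toNat_one, one_mul])

/-- At exponent `1` the q-glue is `gbox (qDepth j)` on `𝔽_l^⋇`. [folklore] -/
theorem qGlueL_one_of_ne_zero {j : splitIndex.Label} (hj : j ≠ 0) (vQ : splitIndex.VQ) : qGlueL 1 j vQ = gbox (qDepth j) := by
  unfold qGlueL; rw [if_neg hj]
  exact congrArg gbox (funext fun c => by rw [Int.toNat_one, one_mul])

/-- At the zero label both glues are the unit box. [folklore] -/
theorem glueL_zero (k : ℤ) (vQ : splitIndex.VQ) : thetaGlueL k 0 vQ = gbox 0 ∧ qGlueL k 0 vQ = gbox 0 := ⟨if_pos rfl, if_pos rfl⟩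

/-- `qGlueL 1` is a hull-set of the deep frame at every label. [folklore] -/
theorem qGlueL_one_mem (j : splitIndex.Label) (vQ : splitIndex.VQ) : qGlueL 1 j vQ ∈ deepHul capL j vQ := by
  by_cases hj : j = 0
  · subst hj; rw [(glueL_zero 1 vQ).2]; exact ⟨0, fun _ => Nat.zero_le _, rfl⟩
  · rw [qGlueL_one_of_ne_zero hj]; exact gbox_mem_deepHul capL vQ (qDepth_le j)

/-- **The setting P♮ˡ of Cor. 3.12** over `linSituation` (column `n = 0`): honest object side (abc-iut-w4-d101's `ExpMonoid`, P♮₁'s `splitSig`,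
pilots of exponent `1`), the DEEP graded frame `deepFrame capL`, glue reading the object. [claim: Mochizuki2012, status: disputed] -/
def linSetting : Setting linSituation where
  n := 0
  HT := ℤ × ℤ
  LogLink := fun _ _ => Unit
  IsFull := fun _ => True
  lattice :=
    { theater := fun n m => (n, m)
      distinct := fun p q h => by simpa using h
      logLink := fun _ _ => ()
      logLink_full := fun _ _ => trivial }
  Frd := Unit
  IsoF := fun _ _ => Unit
  Ob := fun _ => ℤ
  realify := id
  Strip := Unit
  IsoS := fun _ _ => Unit
  M := fun _ _ => ExpMonoid
  sig := splitSig
  split := { Msplit := fun _ _ => ⊤, exists_gen := fun _ _ => ⟨⟨gen, trivial⟩, top_gen_isGenerator⟩ }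
  ObΔ := ℤ
  N := fun _ _ => ExpMonoid
  qData :=
    { q := fun _ _ => gen
      q_gen := fun _ _ => gen_isGenerator
      objOf := fun x => (expOf (x true rfl) : ℤ) }
  frame := fun j vQ => deepFrame capL j vQ
  hul_adm := fun _ _ _ _ => trivial
  thetaRegionOf := fun _ k j vQ => thetaGlueL k j vQ
  qRegionOf := fun k j vQ => qGlueL k j vQ
  qRegion_mem := fun j vQ => qGlueL_one_mem j vQ
  qSupport_finite := fun _ => Set.toFinite _

/-- **The q-pilot's Kummer datum in P♮ˡ**: the q-profile point. MODEL DATA. [claim: Mochizuki2012, status: disputed] -/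
def qDatumL : ∀ v : splitIndex.V, v ∈ splitIndex.Vbad → Set (splitShells.StarPacket v) := fun v _ => {qStarL v}

end LinScaledWitness

end Summit.ABC.IUTFork.Cor312Vol

end
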